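import Summits.RiemannHypothesis.RiemannHypothesis.Theorems.WeilLegendreBlocks136Base
import Literature.NumberTheory.LFunctions.WeilBlockRows
import Literature.NumberTheory.LFunctions.WeilBlockRowsDCFast
import HarnessLib

/-!
# Odd Legendre blocks at `nb = 136`: rows 16–19 of the check `D C = I`

`WeilCert.checkDCRow 1` for the block base `weilBlocks136Base`, row by row via the linear-traversal check `WeilCert.checkDCRowF` (`decide +kernel`) and `WeilCert.checkDCRow_of_F`. Pure proof file; nothing is asserted.
-/

noncomputable section

set_option linter.dupNamespace false

namespace Summit.RiemannHypothesis.RiemannHypothesis.Theorems.EvenWinsBeyondArch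

open Literature.NumberTheory.LFunctions

set_option maxHeartbeats 0 in
/-- Fast kernel check of row 16 of `D C = I` (odd blocks, `nb = 136`; linear traversals). [folklore] -/
theorem checkDCRowF1_16_weilBlocks136 : weilBlocks136Base.checkDCRowF 1 16 = true := by
  decide +kernel

/-- Row 16 of `D C = I` (odd blocks, `nb = 136`), from the fast check. [folklore] -/
theorem checkDCRow1_16_weilBlocks136 : weilBlocks136Base.checkDCRow 1 16 = true :=
  WeilCert.checkDCRow_of_F checkDCRowF1_16_weilBlocks136

set_option maxHeartbeats 0 in
/-- Fast kernel check of row 17 of `D C = I` (odd blocks, `nb = 136`; linear traversals). [folklore] -/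
theorem checkDCRowF1_17_weilBlocks136 : weilBlocks136Base.checkDCRowF 1 17 = true := by
  decide +kernel

/-- Row 17 of `D C = I` (odd blocks, `nb = 136`), from the fast check. [folklore] -/
theorem checkDCRow1_17_weilBlocks136 : weilBlocks136Base.checkDCRow 1 17 = true :=
  WeilCert.checkDCRow_of_F checkDCRowF1_17_weilBlocks136

set_option maxHeartbeats 0 in
/-- Fast kernel check of row 18 of `D C = I` (odd blocks, `nb = 136`; linear traversals). [folklore] -/
theorem checkDCRowF1_18_weilBlocks136 : weilBlocks136Base.checkDCRowF 1 18 = true := by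
  decide +kernel

/-- Row 18 of `D C = I` (odd blocks, `nb = 136`), from the fast check. [folklore] -/
theorem checkDCRow1_18_weilBlocks136 : weilBlocks136Base.checkDCRow 1 18 = true :=
  WeilCert.checkDCRow_of_F checkDCRowF1_18_weilBlocks136

set_option maxHeartbeats 0 in
/-- Fast kernel check of row 19 of `D C = I` (odd blocks, `nb = 136`; linear traversals). [folklore] -/
theorem checkDCRowF1_19_weilBlocks136 : weilBlocks136Base.checkDCRowF 1 19 = true := by
  decide +kernel

/-- Row 19 of `D C = I` (odd blocks, `nb = 136`), from the fast check. [folklore] -/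
theorem checkDCRow1_19_weilBlocks136 : weilBlocks136Base.checkDCRow 1 19 = true :=
  WeilCert.checkDCRow_of_F checkDCRowF1_19_weilBlocks136


end Summit.RiemannHypothesis.RiemannHypothesis.Theorems.EvenWinsBeyondArch
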